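import Summits.Ventures.Crystal3D.Theorems.StickyWulffConstantGenericWallFloorStackWalkWordSep
import Summits.Ventures.Crystal3D.Theorems.StickyWulffConstantGenericWallFloorStackWalkForcedChain
import HarnessLib

/-!
# The WORD CRITERION, level two: chain pairs at twin distance `≥ 3` whose near forced ray may take ONE step along the path
# (crux `GenericWallFloor`, line `WallLedgerG`; forced-chain localisation of the stack ledger, brick 7)

HONEST FRAMING. Part of the venture `Summits/Ventures/Crystal3D` (cell `crystal3d-full`), helper `--supports` the
crux `GenericWallFloor` (stmt-Ventures-19480) of `route-Ventures-StickyWulffConstant`, registered line `WallLedgerG`,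
open stub `stub_twoSlabAdhesion` (general fillings).  `not_coaxial_of_word` (`…StackWalkWordSep`) separates the two
grains' stack frames when the near steep slot lies IN the first mirror plane (`l = 0` in the notation of ROUTE.md §84
R41t) and the far one in the last (`c = 0`).  By R41t the uncovered set is `l + c ≥ k − 1`; for `k ≥ 3` the cell
`(l, c) = (1, 0)` is therefore also separated, and this file proves it in the kernel:

**`not_coaxial_of_word_two`.**  `A₂·Λ₀ = (wordFrame A₁ (κ₀ ++ [μ₂, μ₁]))·Λ₀` with `κ₀ ≠ []` (twin distance `≥ 3`), the
word reduced; `u₂` in the last mirror plane; and — instead of `u₁ ⊥ μ₁` — the LEVEL-TWO hypothesis: if the first push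
normal is `n₁ = ±A₁μ₁` (positive on `A₁u₁`), then for every highest `n₁`-positive slot `q` of the twin frame `R_{n₁}A₁`
(the walk's best capper) the forced second normal `2√(2/3)·R_{n₁}A₁q − n₁`, pulled back to the model, is `≠ ±μ₂`.
Then no frame on a sound well-formed stack over `(A₁,u₁,0)` is co-axial with one over `(A₂,u₂,0)`.
Ingredients: `stackWord_lastTwo` (the bottom two letters of a stack word: first push normal, then the forced normal of
the push entry — `head_eq_pushEntry`/`nrm_eq_nextNormal` of `…StackWalkForcedChain`, `bestCapper_spec`),
`stackWord_lastTwo_ne` (property P2: last letter's mirror `≠ R_{μ₁}` or second-last's `≠ R_{μ₂}`),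
`false_of_map_reflection_eq_two` (equal mirror sequences with a far word of length `≥ 3` ending `μ₂, μ₁` contradict P2),
and the transport/rigidity skeleton of `not_coaxial_of_word` verbatim.  Measure (R41t numerics, Σ27-type words,
steepest slots): `(l,c) = (0,0)` 24 %, `(1,0)` +20 % of Haar orientations.

WHAT THIS IS NOT: not the stub; `(l, c) = (0, 1)` and the ray-aligned core are not touched; F-C1 not moved.
-/

noncomputable section

namespace Summit.Ventures.Crystal3D.Theorems

open Summit.Ventures.Crystal3D Finset
open Literature.MathematicalPhysics.StatisticalMechanics (fccStacking barlowStacking IsHaggSeq)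
open scoped InnerProductSpace

variable {z : EuclideanSpace ℝ (Fin 3)}

/-! ### The bottom two letters of a stack word -/

/-- **The last two letters of a stack word.**  A sound well-formed stack with at least two levels above its
bottom `b` has word `w ++ [e₁.frame⁻¹ e₂.nrm, b.frame⁻¹ e₁.nrm]`, where `e₁` (level one) is sound, linked to `b`
and carries the best capper, and `e₂` (level two) is sound, linked to `e₁`, with a different entry normal. -/
theorem stackWord_lastTwo : ∀ (r : List WalkEntry) (e b : WalkEntry), 2 ≤ r.length → StackSound z (e :: r) →
    StackWF z (e :: r) → (e :: r).getLast? = some b →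
    ∃ (w : List (EuclideanSpace ℝ (Fin 3))) (e₁ e₂ : WalkEntry),
      stackWord (e :: r) = w ++ [e₁.frame.symm e₂.nrm, b.frame.symm e₁.nrm] ∧
      e₁.Sound z ∧ e₁.Link b ∧ e₁.dir = bestCapper e₁.frame e₁.nrm z ∧ e₂.Sound z ∧ e₂.Link e₁ ∧ e₂.nrm ≠ e₁.nrm
  | [], _, _, hl, _, _, _ => by simp at hl
  | [_], _, _, hl, _, _, _ => by simp at hl
  | [x, y], e, b, _, hS, hW, hlast => by
    have hyb : y = b := by simpa using hlast
    subst hyb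
    obtain ⟨hSo, hLi, hS'⟩ := hS
    obtain ⟨hSo₁, hLi₁, -⟩ := hS'
    obtain ⟨-, hne, hW'⟩ := (stackWF_cons_cons z e x [y]).1 hW
    obtain ⟨hdir₁, -, -⟩ := (stackWF_cons_cons z x y []).1 hW'
    exact ⟨[], x, e, by simp [stackWord], hSo₁, hLi₁, hdir₁, hSo, hLi, hne⟩
  | x :: y :: t :: rest, e, b, _, hS, hW, hlast => by
    obtain ⟨-, -, hS'⟩ := hS
    have hW' : StackWF z (x :: y :: t :: rest) := hW.of_cons
    have hlast' : (x :: y :: t :: rest).getLast? = some b := by rw [List.getLast?_cons_cons] at hlast; exact hlast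
    obtain ⟨w, e₁, e₂, hw, h⟩ := stackWord_lastTwo (y :: t :: rest) x b (by simp) hS' hW' hlast'
    exact ⟨x.frame.symm e.nrm :: w, e₁, e₂, by rw [stackWord_cons_cons, hw, List.cons_append], h⟩

/-- The word of a stack `e :: r` has `r.length` letters. -/
theorem length_stackWord_cons : ∀ (r : List WalkEntry) (e : WalkEntry), (stackWord (e :: r)).length = r.length
  | [], _ => rfl
  | x :: t, e => by rw [stackWord_cons_cons, List.length_cons, List.length_cons, length_stackWord_cons t x]

/-- **The contradiction with two end letters.**  Two words of unit letters with the same mirror sequence; the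
second has length `≥ 3` and ends `… μ₂, μ₁`; the first has length `≤ 2` or ends `… l₂, l₁` with `R_{l₁} ≠ R_{μ₁}` or
`R_{l₂} ≠ R_{μ₂}`: absurd. -/
theorem false_of_map_reflection_eq_two {α γ γ₀ : List (EuclideanSpace ℝ (Fin 3))} {μ₁ μ₂ : EuclideanSpace ℝ (Fin 3)}
    (hγ : γ = γ₀ ++ [μ₂, μ₁]) (hγ₀ : γ₀ ≠ [])
    (hP : α.length ≤ 2 ∨ ∃ (w : List (EuclideanSpace ℝ (Fin 3))) (l₂ l₁ : EuclideanSpace ℝ (Fin 3)),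
      α = w ++ [l₂, l₁] ∧ ((ℝ ∙ l₁)ᗮ.reflection ≠ (ℝ ∙ μ₁)ᗮ.reflection ∨ (ℝ ∙ l₂)ᗮ.reflection ≠ (ℝ ∙ μ₂)ᗮ.reflection))
    (hmap : α.map (fun μ => (ℝ ∙ μ)ᗮ.reflection) = γ.map (fun μ => (ℝ ∙ μ)ᗮ.reflection)) : False := by
  have hlen : α.length = γ.length := by simpa using congrArg List.length hmap
  have hγlen : 3 ≤ γ.length := by
    rw [hγ, List.length_append]
    have : 1 ≤ γ₀.length := Nat.one_le_iff_ne_zero.2 fun h => hγ₀ (List.length_eq_zero_iff.1 h)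
    simp; omega
  rcases hP with h2 | ⟨w, l₂, l₁, hα, hne⟩
  · omega
  rw [hα, hγ, List.map_append, List.map_append] at hmap
  have hw : w.length = γ₀.length := by
    have := congrArg List.length hmap
    simp at this; omega
  obtain ⟨-, htail⟩ := List.append_inj hmap (by simpa using hw)
  simp only [List.map_cons, List.map_nil, List.cons.injEq, and_true] at htail
  rcases hne with h | h
  · exact h htail.2
  · exact h htail.1

/-- **The last two letters of a grain's stack word under the level-two hypothesis** (property P2): a sound
well-formed stack over `(A₁, u₁, 0)` has a word of length `≤ 1`, or its last two letters `l₂, l₁` satisfy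
`R_{l₁} ≠ R_{μ₁}` or `R_{l₂} ≠ R_{μ₂}` — the first push normal is positive on `u₁`, and if it is `±A₁μ₁` the second is
the forced normal through the best capper, which the hypothesis keeps off `±μ₂`. -/
theorem stackWord_lastTwo_ne {A₁ : EuclideanSpace ℝ (Fin 3) ≃ₗᵢ[ℝ] EuclideanSpace ℝ (Fin 3)}
    {u₁ μ₁ μ₂ : EuclideanSpace ℝ (Fin 3)} (hμ₁ : ‖μ₁‖ = 1) (hμ₂ : ‖μ₂‖ = 1)
    (hsecond : ∀ n₁ : EuclideanSpace ℝ (Fin 3), (n₁ = A₁ μ₁ ∨ n₁ = -A₁ μ₁) → ⟪A₁ u₁, n₁⟫_ℝ = Real.sqrt (2 / 3) →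
      ∀ q ∈ fccSlots, 0 < ⟪twinFrame A₁ n₁ q, n₁⟫_ℝ →
        (∀ q' ∈ fccSlots, 0 < ⟪twinFrame A₁ n₁ q', n₁⟫_ℝ → ⟪twinFrame A₁ n₁ q', z⟫_ℝ ≤ ⟪twinFrame A₁ n₁ q, z⟫_ℝ) →
        (twinFrame A₁ n₁).symm ((2 * Real.sqrt (2 / 3)) • twinFrame A₁ n₁ q - n₁) ≠ μ₂ ∧
        (twinFrame A₁ n₁).symm ((2 * Real.sqrt (2 / 3)) • twinFrame A₁ n₁ q - n₁) ≠ -μ₂)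
    (r : List WalkEntry) (e : WalkEntry) (hS : StackSound z (e :: r)) (hW : StackWF z (e :: r))
    (hl : (e :: r).getLast? = some ⟨A₁, u₁, 0⟩) :
    (stackWord (e :: r)).length ≤ 1 ∨ ∃ (w : List (EuclideanSpace ℝ (Fin 3))) (l₂ l₁ : EuclideanSpace ℝ (Fin 3)),
      stackWord (e :: r) = w ++ [l₂, l₁] ∧
      ((ℝ ∙ l₁)ᗮ.reflection ≠ (ℝ ∙ μ₁)ᗮ.reflection ∨ (ℝ ∙ l₂)ᗮ.reflection ≠ (ℝ ∙ μ₂)ᗮ.reflection) := by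
  have hr : 0 < Real.sqrt (2 / 3) := Real.sqrt_pos.2 (by norm_num)
  by_cases hlen : 2 ≤ r.length
  swap
  · left; rw [length_stackWord_cons]; omega
  right
  obtain ⟨w, d₁, d₂, hw, hSo₁, hLi₁, hdir₁, hSo₂, hLi₂, hne⟩ := stackWord_lastTwo r e ⟨A₁, u₁, 0⟩ hlen hS hW hl
  refine ⟨w, d₁.frame.symm d₂.nrm, (A₁ : EuclideanSpace ℝ (Fin 3) ≃ₗᵢ[ℝ] EuclideanSpace ℝ (Fin 3)).symm d₁.nrm, hw, ?_⟩
  have hn₁ : ‖d₁.nrm‖ = 1 := hSo₁.2.1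
  have hl₁u : ‖(A₁ : EuclideanSpace ℝ (Fin 3) ≃ₗᵢ[ℝ] EuclideanSpace ℝ (Fin 3)).symm d₁.nrm‖ = 1 := by
    rw [LinearIsometryEquiv.norm_map, hn₁]
  rcases Classical.em ((ℝ ∙ ((A₁ : EuclideanSpace ℝ (Fin 3) ≃ₗᵢ[ℝ] EuclideanSpace ℝ (Fin 3)).symm d₁.nrm))ᗮ.reflection =
      (ℝ ∙ μ₁)ᗮ.reflection) with hR₁ | hR₁
  swap
  · exact Or.inl hR₁
  right
  -- the first push normal is `±A₁ μ₁`: the level-two hypothesis applies to the best capper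
  have hpm : d₁.nrm = A₁ μ₁ ∨ d₁.nrm = -A₁ μ₁ := by
    rcases eq_or_eq_neg_of_reflection_eq hl₁u hμ₁ hR₁ with h | h
    · left; rw [← h, LinearIsometryEquiv.apply_symm_apply]
    · right; rw [← LinearIsometryEquiv.apply_symm_apply A₁ d₁.nrm, h, map_neg]
  have hpos₁ : ⟪A₁ u₁, d₁.nrm⟫_ℝ = Real.sqrt (2 / 3) := hLi₁.2
  have hfr₁ : d₁.frame = twinFrame A₁ d₁.nrm :=
    frame_eq_twinFrame_of_link (e := d₁) (e' := ⟨A₁, u₁, 0⟩) hn₁ hLi₁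
  have hmenuT : ∀ w ∈ fccSlots, ⟪twinFrame A₁ d₁.nrm w, d₁.nrm⟫_ℝ = 0 ∨
      ⟪twinFrame A₁ d₁.nrm w, d₁.nrm⟫_ℝ = Real.sqrt (2 / 3) ∨ ⟪twinFrame A₁ d₁.nrm w, d₁.nrm⟫_ℝ = -Real.sqrt (2 / 3) := by
    rw [← hfr₁]; exact hSo₁.2.2.1
  have hSne : (fccSlots.filter fun q => 0 < ⟪twinFrame A₁ d₁.nrm q, d₁.nrm⟫_ℝ).Nonempty := by
    obtain ⟨p, hp, hpn, -⟩ := exists_pos_slot_ne (twinFrame A₁ d₁.nrm) hn₁ hmenuT 0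
    exact ⟨p, Finset.mem_filter.2 ⟨hp, by rw [hpn]; exact hr⟩⟩
  obtain ⟨hqS, hqmax⟩ := bestCapper_spec (twinFrame A₁ d₁.nrm) d₁.nrm z hSne
  rw [Finset.mem_filter] at hqS
  have hq : d₁.dir = bestCapper (twinFrame A₁ d₁.nrm) d₁.nrm z := by rw [hdir₁, hfr₁]
  obtain ⟨hne₁, hne₂⟩ := hsecond d₁.nrm hpm hpos₁ _ hqS.1 hqS.2
    (fun q' hq' hpos' => hqmax q' (Finset.mem_filter.2 ⟨hq', hpos'⟩))
  -- the second letter is the forced next normal, pulled back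
  have hn₂ : d₂.nrm = nextNormal d₁ := nrm_eq_nextNormal hSo₂ hLi₂ hSo₁ hne
  have hl₂ : d₁.frame.symm d₂.nrm =
      (twinFrame A₁ d₁.nrm).symm ((2 * Real.sqrt (2 / 3)) • twinFrame A₁ d₁.nrm
        (bestCapper (twinFrame A₁ d₁.nrm) d₁.nrm z) - d₁.nrm) := by
    rw [hn₂, nextNormal, hq, hfr₁]
  intro hR₂
  have hl₂u : ‖d₁.frame.symm d₂.nrm‖ = 1 := by rw [LinearIsometryEquiv.norm_map]; exact hSo₂.2.1
  rcases eq_or_eq_neg_of_reflection_eq hl₂u hμ₂ hR₂ with h | h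
  · exact hne₁ (hl₂ ▸ h)
  · exact hne₂ (hl₂ ▸ h)

/-! ### The level-two word criterion -/

/-- **Word criterion, level two** (chain pairs at twin distance `k ≥ 3`).  As `not_coaxial_of_word`, but the near steep
slot `u₁` need NOT lie in the first mirror plane: instead, whenever the first push normal IS the first mirror's normal
(`n₁ = ±A₁μ₁` with `⟪A₁u₁, n₁⟫ = √(2/3)`), every HIGHEST `n₁`-positive slot `q` of the twin frame `R_{n₁}A₁` (the walk's
best capper) must have its second `{111}` plane different from the second mirror: `(R_{n₁}A₁)⁻¹(2√(2/3)·R_{n₁}A₁ q − n₁) ≠ ±μ₂`.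
(The far slot `u₂` still lies in the last mirror plane.)  Then no frame on a sound well-formed stack over `(A₁,u₁,0)` is
co-axial with a frame on a sound well-formed stack over `(A₂,u₂,0)` — the cells with `l ≤ 1`, `c = 0` of ROUTE.md §84 R41t. -/
theorem not_coaxial_of_word_two {A₁ A₂ : EuclideanSpace ℝ (Fin 3) ≃ₗᵢ[ℝ] EuclideanSpace ℝ (Fin 3)}
    {u₁ u₂ : EuclideanSpace ℝ (Fin 3)} (κ₀ : List (EuclideanSpace ℝ (Fin 3))) (μ₂ μ₁ : EuclideanSpace ℝ (Fin 3))
    (hκ₀ : κ₀ ≠ [])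
    (hκl : ∀ μ ∈ κ₀ ++ [μ₂, μ₁], ‖μ‖ = 1 ∧
      ∀ w ∈ fccSlots, ⟪w, μ⟫_ℝ = 0 ∨ ⟪w, μ⟫_ℝ = Real.sqrt (2 / 3) ∨ ⟪w, μ⟫_ℝ = -Real.sqrt (2 / 3))
    (hκc : List.IsChain (fun μ μ' => ⟪μ, μ'⟫_ℝ = 1 / 3 ∨ ⟪μ, μ'⟫_ℝ = -1 / 3) (κ₀ ++ [μ₂, μ₁]))
    (hA₂ : A₂ '' fccStacking 1 (Real.sqrt (2 / 3)) = (wordFrame A₁ (κ₀ ++ [μ₂, μ₁])) '' fccStacking 1 (Real.sqrt (2 / 3)))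
    (hsecond : ∀ n₁ : EuclideanSpace ℝ (Fin 3), (n₁ = A₁ μ₁ ∨ n₁ = -A₁ μ₁) → ⟪A₁ u₁, n₁⟫_ℝ = Real.sqrt (2 / 3) →
      ∀ q ∈ fccSlots, 0 < ⟪twinFrame A₁ n₁ q, n₁⟫_ℝ →
        (∀ q' ∈ fccSlots, 0 < ⟪twinFrame A₁ n₁ q', n₁⟫_ℝ → ⟪twinFrame A₁ n₁ q', z⟫_ℝ ≤ ⟪twinFrame A₁ n₁ q, z⟫_ℝ) →
        (twinFrame A₁ n₁).symm ((2 * Real.sqrt (2 / 3)) • twinFrame A₁ n₁ q - n₁) ≠ μ₂ ∧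
        (twinFrame A₁ n₁).symm ((2 * Real.sqrt (2 / 3)) • twinFrame A₁ n₁ q - n₁) ≠ -μ₂)
    (hlast : ∀ μ, (κ₀ ++ [μ₂, μ₁]).head? = some μ → ⟪A₂ u₂, wordFrame A₁ (κ₀ ++ [μ₂, μ₁]) μ⟫_ℝ = 0)
    {z₂ : EuclideanSpace ℝ (Fin 3)} {stk₁ stk₂ : List WalkEntry}
    (hS₁ : StackSound z stk₁) (hW₁ : StackWF z stk₁) (hl₁ : stk₁.getLast? = some ⟨A₁, u₁, 0⟩)
    (hS₂ : StackSound z₂ stk₂) (hW₂ : StackWF z₂ stk₂) (hl₂ : stk₂.getLast? = some ⟨A₂, u₂, 0⟩)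
    {e₁ e₂ : WalkEntry} (he₁ : e₁ ∈ stk₁) (he₂ : e₂ ∈ stk₂) :
    ¬ ∃ (L : EuclideanSpace ℝ (Fin 3) ≃ₗᵢ[ℝ] EuclideanSpace ℝ (Fin 3))
        (s₁ s₂ : EuclideanSpace ℝ (Fin 3)) (σ σ' : ℤ → ℤ), IsHaggSeq σ ∧ IsHaggSeq σ' ∧
        e₁.frame '' fccStacking 1 (Real.sqrt (2 / 3)) ⊆ (fun p => L p + s₁) '' barlowStacking 1 (Real.sqrt (2 / 3)) σ ∧
        e₂.frame '' fccStacking 1 (Real.sqrt (2 / 3)) ⊆ (fun p => L p + s₂) '' barlowStacking 1 (Real.sqrt (2 / 3)) σ' := by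
  set κ := κ₀ ++ [μ₂, μ₁] with hκdef
  intro hco
  have hr : 0 < Real.sqrt (2 / 3) := Real.sqrt_pos.2 (by norm_num)
  have hμ₁ := hκl μ₁ (by rw [hκdef]; simp)
  have hμ₂ := hκl μ₂ (by rw [hκdef]; simp)
  -- suffixes with the given tops
  obtain ⟨r₁, hS₁', hW₁', hl₁'⟩ := exists_suffix_of_mem stk₁ e₁ he₁ hS₁ hW₁
  obtain ⟨r₂, hS₂', hW₂', hl₂'⟩ := exists_suffix_of_mem stk₂ e₂ he₂ hS₂ hW₂
  rw [hl₁] at hl₁'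
  rw [hl₂] at hl₂'
  obtain ⟨hαl, hαc⟩ := stackWord_letters _ hS₁' hW₁'
  obtain ⟨hβl, hβc⟩ := stackWord_letters _ hS₂' hW₂'
  have hF₁ : e₁.frame = wordFrame A₁ (stackWord (e₁ :: r₁)) := by
    rw [frame_eq_wordFrame e₁ r₁ hS₁', stackBase_eq_of_getLast? hl₁']
  have hF₂ : e₂.frame = wordFrame A₂ (stackWord (e₂ :: r₂)) := by
    rw [frame_eq_wordFrame e₂ r₂ hS₂', stackBase_eq_of_getLast? hl₂']
  have hβpos : ∀ μ, (stackWord (e₂ :: r₂)).getLast? = some μ → ⟪u₂, μ⟫_ℝ = Real.sqrt (2 / 3) :=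
    fun μ hμ => inner_dir_getLast_stackWord r₂ e₂ ⟨A₂, u₂, 0⟩ hS₂' hl₂' μ hμ
  -- property P2 of the near word
  have hP2 := stackWord_lastTwo_ne (z := z) hμ₁.1 hμ₂.1 hsecond r₁ e₁ hS₁' hW₁' hl₁'
  -- the lattice symmetry `S = W⁻¹ ∘ A₂`
  obtain ⟨S, hS⟩ : ∃ S : EuclideanSpace ℝ (Fin 3) ≃ₗᵢ[ℝ] EuclideanSpace ℝ (Fin 3),
      S = A₂.trans (wordFrame A₁ κ).symm := ⟨_, rfl⟩
  have hWS : ∀ x, wordFrame A₁ κ (S x) = A₂ x := fun x => by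
    rw [hS, LinearIsometryEquiv.trans_apply, LinearIsometryEquiv.apply_symm_apply]
  have hA₂eq : A₂ = S.trans (wordFrame A₁ κ) :=
    LinearIsometryEquiv.ext fun x => by rw [LinearIsometryEquiv.trans_apply, hWS]
  have hSfcc : S '' fccStacking 1 (Real.sqrt (2 / 3)) = fccStacking 1 (Real.sqrt (2 / 3)) := by
    rw [hS, LinearIsometryEquiv.coe_trans, Set.image_comp, hA₂, Set.image_image]
    simp
  have hSslots := image_fccSlots_eq_self_of_image_fcc S hSfcc
  have hSmem' : ∀ w ∈ fccSlots, S.symm w ∈ fccSlots := fun w hw => by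
    have hw' : w ∈ (S : EuclideanSpace ℝ (Fin 3) → EuclideanSpace ℝ (Fin 3)) '' ↑fccSlots := by
      rw [hSslots]; exact Finset.mem_coe.2 hw
    obtain ⟨w', hw', hw'eq⟩ := hw'
    rw [← hw'eq, LinearIsometryEquiv.symm_apply_apply]; exact Finset.mem_coe.1 hw'
  -- the transported far word `γ = (β.map S) ++ κ`
  set β := stackWord (e₂ :: r₂) with hβ
  have hβSl : ∀ μ ∈ β.map S, ‖μ‖ = 1 ∧
      ∀ w ∈ fccSlots, ⟪w, μ⟫_ℝ = 0 ∨ ⟪w, μ⟫_ℝ = Real.sqrt (2 / 3) ∨ ⟪w, μ⟫_ℝ = -Real.sqrt (2 / 3) := by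
    intro μ hμ
    obtain ⟨ν, hν, rfl⟩ := List.mem_map.1 hμ
    obtain ⟨hνu, hνm⟩ := hβl ν hν
    refine ⟨by rw [LinearIsometryEquiv.norm_map, hνu], fun w hw => ?_⟩
    have hsw : ⟪w, S ν⟫_ℝ = ⟪S.symm w, ν⟫_ℝ := by
      rw [← LinearIsometryEquiv.inner_map_map S (S.symm w) ν, LinearIsometryEquiv.apply_symm_apply]
    rw [hsw]; exact hνm _ (hSmem' w hw)
  have hβSc : List.IsChain (fun μ μ' => ⟪μ, μ'⟫_ℝ = 1 / 3 ∨ ⟪μ, μ'⟫_ℝ = -1 / 3) (β.map S) := by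
    rw [List.isChain_map]; simpa only [LinearIsometryEquiv.inner_map_map] using hβc
  have hγl : ∀ μ ∈ β.map S ++ κ, ‖μ‖ = 1 ∧
      ∀ w ∈ fccSlots, ⟪w, μ⟫_ℝ = 0 ∨ ⟪w, μ⟫_ℝ = Real.sqrt (2 / 3) ∨ ⟪w, μ⟫_ℝ = -Real.sqrt (2 / 3) := by
    intro μ hμ
    rcases List.mem_append.1 hμ with h | h
    · exact hβSl μ h
    · exact hκl μ h
  have hγc : List.IsChain (fun μ μ' => ⟪μ, μ'⟫_ℝ = 1 / 3 ∨ ⟪μ, μ'⟫_ℝ = -1 / 3) (β.map S ++ κ) := by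
    rw [List.isChain_append]
    refine ⟨hβSc, hκc, fun x hx y hy => ?_⟩
    rw [List.getLast?_map, Option.mem_def, Option.map_eq_some_iff] at hx
    obtain ⟨ν, hν, rfl⟩ := hx
    rw [Option.mem_def] at hy
    obtain ⟨hxu, hxm⟩ := hβSl (S ν) (List.mem_map.2 ⟨ν, List.mem_of_getLast? hν, rfl⟩)
    obtain ⟨hyu, hym⟩ := hκl y (List.mem_of_head? hy)
    have hpos : ⟪S u₂, S ν⟫_ℝ = Real.sqrt (2 / 3) := by rw [LinearIsometryEquiv.inner_map_map]; exact hβpos ν hν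
    have horth : ⟪S u₂, y⟫_ℝ = 0 := by
      rw [← LinearIsometryEquiv.inner_map_map (wordFrame A₁ κ), hWS]; exact hlast y hy
    rcases inner_modelMenu hxu hyu hxm hym with h | h | h | h
    · have heq : S ν = y := (inner_eq_one_iff_of_norm_eq_one (𝕜 := ℝ) hxu hyu).1 h
      rw [heq, horth] at hpos; exact absurd hpos (ne_of_lt hr)
    · have heq : y = -S ν := eq_neg_of_inner_eq_neg_one' hxu hyu h
      rw [heq, inner_neg_right, hpos] at horth; linarith
    · exact Or.inl h
    · exact Or.inr h
  have hγdec : β.map S ++ κ = (β.map S ++ κ₀) ++ [μ₂, μ₁] := by rw [hκdef, List.append_assoc]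
  have hγ₀ : β.map S ++ κ₀ ≠ [] := by simp [hκ₀]
  -- the far frame's slot dozen as a word over `A₁`
  have himg₂ : (e₂.frame : EuclideanSpace ℝ (Fin 3) → EuclideanSpace ℝ (Fin 3)) '' ↑fccSlots =
      (wordFrame A₁ (β.map S ++ κ) : EuclideanSpace ℝ (Fin 3) → EuclideanSpace ℝ (Fin 3)) '' ↑fccSlots := by
    rw [hF₂, hA₂eq, wordFrame_trans (wordFrame A₁ κ) S β (fun μ hμ => (hβl μ hμ).1), ← wordFrame_append,
      image_trans_eq, hSslots]
  -- the main step: a reduced word for a lattice co-axial with `e₁.frame`'s, compared with the far word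
  have main : ∀ α : List (EuclideanSpace ℝ (Fin 3)),
      (∀ μ ∈ α, ‖μ‖ = 1 ∧
        ∀ w ∈ fccSlots, ⟪w, μ⟫_ℝ = 0 ∨ ⟪w, μ⟫_ℝ = Real.sqrt (2 / 3) ∨ ⟪w, μ⟫_ℝ = -Real.sqrt (2 / 3)) →
      List.IsChain (fun μ μ' => ⟪μ, μ'⟫_ℝ = 1 / 3 ∨ ⟪μ, μ'⟫_ℝ = -1 / 3) α →
      (α.length ≤ 2 ∨ ∃ (w : List (EuclideanSpace ℝ (Fin 3))) (l₂ l₁ : EuclideanSpace ℝ (Fin 3)),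
        α = w ++ [l₂, l₁] ∧
        ((ℝ ∙ l₁)ᗮ.reflection ≠ (ℝ ∙ μ₁)ᗮ.reflection ∨ (ℝ ∙ l₂)ᗮ.reflection ≠ (ℝ ∙ μ₂)ᗮ.reflection)) →
      (wordFrame A₁ α : EuclideanSpace ℝ (Fin 3) → EuclideanSpace ℝ (Fin 3)) '' ↑fccSlots =
        (wordFrame A₁ (β.map S ++ κ) : EuclideanSpace ℝ (Fin 3) → EuclideanSpace ℝ (Fin 3)) '' ↑fccSlots → False :=
    fun α hl hc hP himg => false_of_map_reflection_eq_two hγdec hγ₀ hP (map_reflection_eq_of_image_eq A₁ hl hc hγl hγc himg)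
  -- P2 transfers
  have hP2α : (stackWord (e₁ :: r₁)).length ≤ 2 ∨ ∃ (w : List (EuclideanSpace ℝ (Fin 3))) (l₂ l₁ : EuclideanSpace ℝ (Fin 3)),
      stackWord (e₁ :: r₁) = w ++ [l₂, l₁] ∧
      ((ℝ ∙ l₁)ᗮ.reflection ≠ (ℝ ∙ μ₁)ᗮ.reflection ∨ (ℝ ∙ l₂)ᗮ.reflection ≠ (ℝ ∙ μ₂)ᗮ.reflection) :=
    hP2.imp_left fun h => by omega
  rcases eq_or_twin_of_coaxial e₁.frame e₂.frame hco with hEq | ⟨m, hm, hmenu, hEq⟩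
  · -- equal lattices
    have himg := image_fccSlots_eq_of_image_fcc_eq _ _ hEq
    rw [hF₁, himg₂] at himg
    exact main _ hαl hαc hP2α himg
  · -- mirror twins: one more letter `m' = e₁.frame⁻¹ m` in front of the near word
    set m' := e₁.frame.symm m with hm'
    have hm'u : ‖m'‖ = 1 := by rw [hm', LinearIsometryEquiv.norm_map, hm]
    have hm'm : ∀ w ∈ fccSlots, ⟪w, m'⟫_ℝ = 0 ∨ ⟪w, m'⟫_ℝ = Real.sqrt (2 / 3) ∨ ⟪w, m'⟫_ℝ = -Real.sqrt (2 / 3) := by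
      intro w hw
      rw [hm', ← LinearIsometryEquiv.inner_map_map e₁.frame, LinearIsometryEquiv.apply_symm_apply]
      exact hmenu w hw
    have htw : twinFrame e₁.frame m = wordFrame A₁ (m' :: stackWord (e₁ :: r₁)) := by
      rw [twinFrame_eq_reflection_trans e₁.frame hm, wordFrame_cons, ← hm', ← hF₁]
    have himg := image_fccSlots_eq_of_image_fcc_eq _ _ hEq
    rw [himg₂, htw] at himg
    cases hα : stackWord (e₁ :: r₁) with
    | nil =>
      rw [hα] at himg
      exact main [m'] (fun μ hμ => by rw [List.mem_singleton] at hμ; rw [hμ]; exact ⟨hm'u, hm'm⟩)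
        (List.isChain_singleton _) (Or.inl (by simp)) himg.symm
    | cons a α' =>
      rw [hα] at himg hαl hαc hP2
      obtain ⟨hau, ham⟩ := hαl a List.mem_cons_self
      -- P2 for the tail and for the extended word
      have hPtail : α'.length ≤ 2 ∨ ∃ (w : List (EuclideanSpace ℝ (Fin 3))) (l₂ l₁ : EuclideanSpace ℝ (Fin 3)),
          α' = w ++ [l₂, l₁] ∧
          ((ℝ ∙ l₁)ᗮ.reflection ≠ (ℝ ∙ μ₁)ᗮ.reflection ∨ (ℝ ∙ l₂)ᗮ.reflection ≠ (ℝ ∙ μ₂)ᗮ.reflection) := by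
        rcases hP2 with h | ⟨w, l₂, l₁, hw, hp⟩
        · left; simp only [List.length_cons] at h; omega
        · cases w with
          | nil => left; simp at hw; obtain ⟨-, rfl⟩ := hw; simp
          | cons v w' =>
            right
            simp only [List.cons_append, List.cons.injEq] at hw
            exact ⟨w', l₂, l₁, hw.2, hp⟩
      have hPfull : (m' :: a :: α').length ≤ 2 ∨
          ∃ (w : List (EuclideanSpace ℝ (Fin 3))) (l₂ l₁ : EuclideanSpace ℝ (Fin 3)),
          (m' :: a :: α') = w ++ [l₂, l₁] ∧
          ((ℝ ∙ l₁)ᗮ.reflection ≠ (ℝ ∙ μ₁)ᗮ.reflection ∨ (ℝ ∙ l₂)ᗮ.reflection ≠ (ℝ ∙ μ₂)ᗮ.reflection) := by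
        rcases hP2 with h | ⟨w, l₂, l₁, hw, hp⟩
        · left; simp only [List.length_cons] at h ⊢; omega
        · exact Or.inr ⟨m' :: w, l₂, l₁, by rw [hw, List.cons_append], hp⟩
      rcases inner_modelMenu hm'u hau hm'm ham with h | h | h | h
      · -- `m' = a`: the two mirrors cancel
        have hma : m' = a := (inner_eq_one_iff_of_norm_eq_one (𝕜 := ℝ) hm'u hau).1 h
        rw [wordFrame_cons_cons_cancel A₁ (by rw [hma]) α'] at himg
        exact main α' (fun μ hμ => hαl μ (List.mem_cons_of_mem a hμ)) hαc.tail hPtail himg.symm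
      · -- `m' = −a`: the same mirror, cancel again
        have hma : a = -m' := eq_neg_of_inner_eq_neg_one' hm'u hau h
        have hR : (ℝ ∙ m')ᗮ.reflection = (ℝ ∙ a)ᗮ.reflection := by rw [hma, reflection_neg_eq hm'u]
        rw [wordFrame_cons_cons_cancel A₁ hR α'] at himg
        exact main α' (fun μ hμ => hαl μ (List.mem_cons_of_mem a hμ)) hαc.tail hPtail himg.symm
      · exact main (m' :: a :: α') (fun μ hμ => by
            rcases List.mem_cons.1 hμ with rfl | hμ'
            · exact ⟨hm'u, hm'm⟩
            · exact hαl μ hμ')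
          (List.isChain_cons.2 ⟨fun b hb => by
            rw [List.head?_cons, Option.mem_some_iff] at hb; rw [← hb]; exact Or.inl h, hαc⟩) hPfull himg.symm
      · exact main (m' :: a :: α') (fun μ hμ => by
            rcases List.mem_cons.1 hμ with rfl | hμ'
            · exact ⟨hm'u, hm'm⟩
            · exact hαl μ hμ')
          (List.isChain_cons.2 ⟨fun b hb => by
            rw [List.head?_cons, Option.mem_some_iff] at hb; rw [← hb]; exact Or.inr h, hαc⟩) hPfull himg.symm


end Summit.Ventures.Crystal3D.Theorems

end
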